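import Mathlib
import Summits.ValiantsHypothesis.ValiantsHypothesis.Theorems.PerDivisionHard.Negative.PerLowDegreeRung
import Summits.ValiantsHypothesis.ValiantsHypothesis.Theorems.DivisionGapZeroOneTransferProjClosureAux

/-!
# Crux `DivisionGap.ZeroOneTransfer` (stmt-ValiantsHypothesis-5066), line `charged-uncharged`, Part E (lead c13) —
stubs `stub_botComponent_avoid_perPoly` (P4), `stub_botComponent_eq_monomial_gen` (P5) and
`stub_support_perKill_perAvoid` (P6) of Part E-IV (the H1 transfer of rung E-II: cofactors of the
PERMANENT with few monomials) — bottom forms of `per_n` and the support of `perKill`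

The variables of `per_n = perPoly (Fin n) ℝ≥0 = ∑_π x^(permMonomial π)`, `permMonomial π = ∑_i e_(π i, i)`,
are the cells `(row, column) : Fin n × Fin n`; the bottom component `ProjClosure.botComponent p X`
keeps the terms of `X` of minimal `p`-weight.

* P4 (`stub_botComponent_avoid_perPoly`): the `p`-weight of `permMonomial π` is `∑_i p (π i, i)`
  (`PerForms.weight_permMonomial`); for a penalty `p` positive exactly on a set `F` of OFF-DIAGONAL
  cells it vanishes iff `π` avoids `F` (`∀ i, (π i, i) ∉ F`), and the identity avoids `F`, so the
  bottom degree of `per_n` is `0` and its bottom component is the sub-sum of the permutation monomials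
  avoiding `F` (coefficient comparison, `permMonomial` injective).
* P5 (`stub_botComponent_eq_monomial_gen`): a strict `p`-minimiser `û` of the support of `X` has
  `botDegree p X = weight p û` and is the only exponent of that weight, so the bottom component is the
  single term `coeff û X · x^û` (the proof of `stub_botComponent_eq_monomial` of
  `DivisionGapZeroOneTransferFaceIsolationForms`, for an arbitrary variable type).
* P6 (`stub_support_perKill_perAvoid`): under `perKill R` (rows `R ↦ 1`, cells `(Rᶜ, R) ↦ 0`, the
  rest renamed to the complement of `R`) the sub-sum of `per_n` over the permutations avoiding `F`
  becomes the sum of the monomials of the shrunk permutations over the avoiding permutations mapping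
  `R` into `R` (`PerForms.aeval_perKill_sum_avoid`, as `aeval_perKill_perPoly`); if `F` is
  off-diagonal with both coordinates of each cell in `R`, every permutation `σ` of the complement is
  the shrink of `Equiv.Perm.ofSubtype σ`, which maps `R` into `R` and avoids `F` (on `R` it is the
  identity and `F` is off-diagonal; off `R` the column is not in `R`), so the support is that of the
  permanent of the complement (`support_perPoly_univ`).
[folklore]
-/

noncomputable section

set_option linter.dupNamespace false

namespace Summit.ValiantsHypothesis.ValiantsHypothesis.Theorems.DivisionGapZeroOneTransfer

open MvPolynomial
open Literature.Computability.AlgebraicComplexity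
open Summit.ValiantsHypothesis.ValiantsHypothesis.Theorems.ZeroOneTransfer
open Summit.ValiantsHypothesis.ValiantsHypothesis.Theorems.PerDivisionHard.Negative
open scoped NNReal BigOperators

namespace PerForms

variable {n : ℕ}

/-- The `p`-weight of a permutation monomial is the total weight of its cells. [folklore] -/
theorem weight_permMonomial (p : Fin n × Fin n → ℕ) (π : Equiv.Perm (Fin n)) :
    Finsupp.weight p (permMonomial π) = ∑ i, p (π i, i) := by
  show Finsupp.weight p (∑ i, Finsupp.single (π i, i) 1) = _
  rw [map_sum]
  refine Finset.sum_congr rfl fun i _ => ?_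
  rw [Finsupp.weight_single, smul_eq_mul, one_mul]

/-- For a penalty positive exactly on `F`, a permutation monomial has weight `0` iff the permutation
avoids `F`. [folklore] -/
theorem weight_permMonomial_eq_zero_iff {F : Finset (Fin n × Fin n)} {p : Fin n × Fin n → ℕ}
    (hpos : ∀ e ∈ F, 0 < p e) (hzero : ∀ e, e ∉ F → p e = 0) (π : Equiv.Perm (Fin n)) :
    Finsupp.weight p (permMonomial π) = 0 ↔ ∀ i, (π i, i) ∉ F := by
  rw [weight_permMonomial, Finset.sum_eq_zero_iff]
  constructor
  · intro h i hi
    exact (hpos _ hi).ne' (h i (Finset.mem_univ _))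
  · intro h i _
    exact hzero _ (h i)

-- adapted from PerDivisionHard/Negative/PerLowDegreeRung (`aeval_perKill_perPoly`)
/-- A sub-sum of `per_n` under `perKill`: the sum of the monomials of the shrunk permutations, over
the permutations of the sub-sum mapping `R` into `R`. [folklore] -/
theorem aeval_perKill_sum_avoid (R : Finset (Fin n)) (S : Finset (Equiv.Perm (Fin n))) :
    aeval (perKill R) (∑ π ∈ S, monomial (permMonomial π) (1 : ℝ≥0)) =
      ∑ π ∈ S.filter (fun π => ∀ i ∈ R, π i ∈ R),
        monomial (permMonomial (shrinkPerm R π)) (1 : ℝ≥0) := by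
  classical
  rw [map_sum, Finset.sum_filter]
  refine Finset.sum_congr rfl fun π _ => ?_
  rw [show (monomial (permMonomial π) (1 : ℝ≥0) : MvPolynomial _ ℝ≥0) = ∏ i, X (π i, i) by
    rw [permMonomial, monomial_sum_one]; rfl]
  rw [map_prod]
  simp only [aeval_X]
  split_ifs with h
  · rw [prod_perKill_of_maps R h, permMonomial, monomial_sum_one]; rfl
  · push Not at h
    exact prod_perKill_of_not_maps R h

end PerForms

/-- **Stub P4 — bottom form of `per_n` under an off-diagonal penalty**: the permutations of penalty
`0` are those avoiding `F`, and the identity is one of them. [folklore] -/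
theorem stub_botComponent_avoid_perPoly : ∀ (n : ℕ) (F : Finset (Fin n × Fin n)) (p : Fin n × Fin n → ℕ),
    (∀ e ∈ F, e.1 ≠ e.2) → (∀ e ∈ F, 0 < p e) → (∀ e, e ∉ F → p e = 0) →
    ProjClosure.botComponent p (perPoly (Fin n) ℝ≥0) =
      ∑ π ∈ (Finset.univ : Finset (Equiv.Perm (Fin n))).filter (fun π => ∀ i, (π i, i) ∉ F),
        monomial (permMonomial π) (1 : ℝ≥0) := by
  intro n F p hFoff hpos hzero
  have hw0 := PerForms.weight_permMonomial_eq_zero_iff hpos hzero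
  -- the identity avoids the off-diagonal set `F`, so the bottom degree is `0`
  have hid : Finsupp.weight p (permMonomial (1 : Equiv.Perm (Fin n))) = 0 :=
    (hw0 1).2 fun i hi => hFoff _ hi rfl
  have hmem : permMonomial (1 : Equiv.Perm (Fin n)) ∈ (perPoly (Fin n) ℝ≥0).support := by
    rw [mem_support_iff, coeff_permMonomial_perPoly]; exact one_ne_zero
  have hbot : ProjClosure.botDegree p (perPoly (Fin n) ℝ≥0) = 0 :=
    Nat.le_zero.1 ((ProjClosure.botDegree_le p hmem).trans_eq hid)
  refine MvPolynomial.ext _ _ fun d => ?_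
  rw [ProjClosure.coeff_botComponent, hbot, coeff_perPoly, coeff_sum]
  simp only [coeff_monomial]
  rw [Finset.sum_filter]
  by_cases hwd : Finsupp.weight p d = 0
  · rw [if_pos hwd]
    refine Finset.sum_congr rfl fun π _ => ?_
    by_cases hπd : permMonomial π = d
    · subst hπd
      rw [if_pos ((hw0 π).1 hwd)]
    · rw [if_neg hπd, ite_self]
  · rw [if_neg hwd]
    symm
    refine Finset.sum_eq_zero fun π _ => ?_
    by_cases hπd : permMonomial π = d
    · subst hπd
      rw [if_neg (fun h => hwd ((hw0 π).2 h))]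
    · rw [if_neg hπd, ite_self]

-- adapted from DivisionGapZeroOneTransferFaceIsolationForms (`stub_botComponent_eq_monomial`)
/-- **Stub P5 — a strict minimiser is the whole bottom form (any variable type).** [folklore] -/
theorem stub_botComponent_eq_monomial_gen : ∀ (σ : Type) [DecidableEq σ] (p : σ → ℕ)
    (X : MvPolynomial σ ℝ≥0) (û : σ →₀ ℕ), û ∈ X.support →
    (∀ u ∈ X.support, u ≠ û → Finsupp.weight p û < Finsupp.weight p u) →
    ProjClosure.botComponent p X = monomial û (coeff û X) := by
  intro σ _ p X û hû hmin
  have hX : X ≠ 0 := by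
    intro h
    rw [h, support_zero] at hû
    exact absurd hû (Finset.notMem_empty _)
  have hbot : ProjClosure.botDegree p X = Finsupp.weight p û := by
    apply le_antisymm (ProjClosure.botDegree_le p hû)
    obtain ⟨d, hd, hdw⟩ := ProjClosure.exists_weight_eq_botDegree p hX
    rw [← hdw]
    by_cases hdu : d = û
    · rw [hdu]
    · exact (hmin d hd hdu).le
  refine MvPolynomial.ext _ _ fun m => ?_
  rw [ProjClosure.coeff_botComponent, hbot, coeff_monomial]
  by_cases hm : û = m
  · subst hm
    simp
  · rw [if_neg hm]
    split_ifs with hw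
    · by_contra hne
      exact absurd hw (hmin m (mem_support_iff.2 hne) (Ne.symm hm)).ne'
    · rfl

-- adapted from PerDivisionHard/Negative/PerLowDegreeRung (`support_aeval_perKill_perPoly`)
/-- **Stub P6 — `perKill` of the avoiding permutations has the support of the permanent of the
complement** when `F` is off-diagonal and `R` contains both coordinates of every cell of `F` (extend a
permutation of the complement by the identity on `R`). [folklore] -/
theorem stub_support_perKill_perAvoid : ∀ (n : ℕ) (F : Finset (Fin n × Fin n)) (R : Finset (Fin n)),
    (∀ e ∈ F, e.1 ≠ e.2) → (∀ e ∈ F, e.1 ∈ R ∧ e.2 ∈ R) →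
    (MvPolynomial.aeval (perKill R)
      (∑ π ∈ (Finset.univ : Finset (Equiv.Perm (Fin n))).filter (fun π => ∀ i, (π i, i) ∉ F),
        monomial (permMonomial π) (1 : ℝ≥0))).support =
      (perPoly {a : Fin n // a ∉ R} ℝ≥0).support := by
  intro n F R hFoff hRF
  classical
  rw [PerForms.aeval_perKill_sum_avoid,
    Summit.ValiantsHypothesis.ValiantsHypothesis.Theorems.ZeroOneTransfer.Negative.support_sum_monomial_one,
    support_perPoly_univ]
  ext d
  simp only [Finset.mem_image, Finset.mem_filter, Finset.mem_univ, true_and]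
  constructor
  · rintro ⟨π, -, rfl⟩
    exact ⟨shrinkPerm R π, rfl⟩
  · rintro ⟨σ, rfl⟩
    have hfix : ∀ i ∈ R, Equiv.Perm.ofSubtype σ i = i := fun i hi =>
      Equiv.Perm.ofSubtype_apply_of_not_mem σ (show ¬ (i ∉ R) from not_not.mpr hi)
    have hmaps : ∀ i ∈ R, Equiv.Perm.ofSubtype σ i ∈ R := fun i hi => by
      rw [hfix i hi]; exact hi
    have havoid : ∀ i, (Equiv.Perm.ofSubtype σ i, i) ∉ F := by
      intro i hmemF
      by_cases hi : i ∈ R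
      · rw [hfix i hi] at hmemF
        exact hFoff _ hmemF rfl
      · exact hi (hRF _ hmemF).2
    refine ⟨Equiv.Perm.ofSubtype σ, ⟨havoid, hmaps⟩, ?_⟩
    congr 1
    rw [shrinkPerm, dif_pos hmaps]
    refine Equiv.ext fun x => Subtype.ext ?_
    show (Equiv.Perm.ofSubtype σ) x.1 = (σ x).1
    exact Equiv.Perm.ofSubtype_apply_coe σ x

end Summit.ValiantsHypothesis.ValiantsHypothesis.Theorems.DivisionGapZeroOneTransfer

end
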